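import Summits.QuantumFields.GaugeBoot.BootstrapSiteCutsAllAxes
import HarnessLib

/-!
# `U(N)` (and `U(1)`): every reflection cut family of the torus bootstrap except the diagonal one is
# sound at EVERY coupling (gauge-boot, L3 ↔ L1)

HONEST FRAMING (cell `pub-gaugeboot`, page 1 of every file): the venture produces certified bounds
on lattice expectations at stated coupling, gauge group, dimension and torus size; NOT a mass gap,
NOT a continuum limit, NOT a string tension; NOT Yang–Mills-summit-bearing (barriers
`FixedCouplingUltralocality`, `PerturbativeInvisibility`). Structural; it certifies no number.

## Content

The `U(N)` counterpart of `BootstrapReflectionCutConsistency` / `BootstrapLinkCutsAllAxes` /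
`BootstrapSiteCutsAllAxes`. For `U(N)` the central element `-1` makes the link reflection
positivity of the torus Wilson measure hold at EVERY real `β` (`cubicTorus_linkRP_uN_anyBeta`), and
site RP holds at every `β` for every group; so for `U(N)` lattice gauge theory on `(ℤ/2Q)^d`,
`Q ≥ 2` — `U(1)` included — both Kazakov–Zheng cut families along every axis are sound at every
coupling, while the diagonal family stays inconsistent in `d ≥ 3` (`diagCuts_eventually_infeasible_uN`):

* `isBootstrapFeasible_wilson_uN`, `levelValuesUN`, `wilson_mem_levelValues_uN`,
  `levelValues_subset_Icc_uN` — the `U(N)` word truncation is a sound convergent relaxation (the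
  `SU(N)` versions are in `BootstrapConvergence` / `BootstrapWordTruncation`);
* `rpCutLevelValuesUN Θ S n P`, ★★ `wilson_mem_rpCutLevelValues_uN` (RP ⇒ sound),
  ★★★ `rpCutLevelValues_eventually_eq_empty_uN` (not RP ⇒ eventually infeasible),
  ★★★ `rpCuts_sound_iff_uN` — consistent iff reflection positive, for `U(N)`;
* ★★★ `wilson_mem_siteCut_uN`, `wilson_mem_linkCut_uN` — on `(ℤ/2Q)^d`, `Q ≥ 2`, every axis, EVERY
  real `β`, every `N`: the site cuts and the link cuts keep the `U(N)` Wilson value feasible at every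
  level; ★★★ `threeFamilies_uN` — `d ≥ 3`, every `β`, `N ≥ 1`: site ✓, link ✓, diagonal ✗.

References: V. Kazakov, Z. Zheng, arXiv:2203.11360 §3.1; K. Osterwalder, E. Seiler, Ann. Phys.
110 (1978) 440 §2. Folklore-level.
-/

noncomputable section

open MeasureTheory Filter Topology NormedSpace
open scoped ComplexOrder
open Literature.MathematicalPhysics.QuantumFieldTheory (LatticeRep Site Edge GaugeConfig IsGaugeInvariant wilsonAction
  wilsonMeasure isProbabilityMeasure_wilsonMeasure)

namespace Summit.QuantumFields.GaugeBoot

open Literature.MathematicalPhysics.QuantumLattice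
open TiltedRP (cubicUnit cubicAxisCoord)

/-! ## The `U(N)` word truncation: sound and convergent -/

section Words

variable {d L : ℕ} [NeZero L] (N : ℕ) (β : ℝ)

/-- **The `U(N)` Wilson expectation is feasible at every polynomial level.** [folklore] -/
theorem isBootstrapFeasible_wilson_uN
    (μ : Measure (GaugeConfig d L (Matrix.unitaryGroup (Fin N) ℂ))) [IsProbabilityMeasure μ]
    (hμ : μ = wilsonMeasure (unitaryFundamentalRep (Fin N) ℂ) β)
    {V : Set C(GaugeConfig d L (Matrix.unitaryGroup (Fin N) ℂ), ℝ)}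
    (hV : V ⊆ polyAlgebra (ι := Edge d L) (unitaryFundamentalLatticeRep N)) :
    IsBootstrapFeasible (unitaryFundamentalLatticeRep N) (uExp N)
      (fun _ => wilsonAction (unitaryFundamentalRep (Fin N) ℂ)) β V (expectationFunctional μ) :=
  isBootstrapFeasible_expectationFunctional (unitaryFundamentalLatticeRep N) (uExp_add N)
    (X := fun X : UGenerator N => (X : Matrix (Fin N) (Fin N) ℂ)) (rho_uExp N)
    (fun _ => wilsonAction_mem_polyFunctions (unitaryFundamentalLatticeRep N)) μ
    ((eq_wilsonMeasure_iff_polySD_uN N β μ).1 hμ) hV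

/-- **The level-`n` feasible values of `P`** in the word-length-`n` `U(N)` bootstrap. [folklore] -/
def levelValuesUN (n : ℕ) (P : C(GaugeConfig d L (Matrix.unitaryGroup (Fin N) ℂ), ℝ)) : Set ℝ :=
  {t | ∃ φ : C(GaugeConfig d L (Matrix.unitaryGroup (Fin N) ℂ), ℝ) →ₗ[ℝ] ℝ,
    IsBootstrapFeasible (unitaryFundamentalLatticeRep N) (uExp N)
        (fun _ => wilsonAction (unitaryFundamentalRep (Fin N) ℂ)) β
        (wordTruncation (ι := Edge d L) (unitaryFundamentalLatticeRep N) n) φ ∧ φ P = t}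

/-- **The `U(N)` Wilson value is feasible at every word level.** [folklore] -/
theorem wilson_mem_levelValues_uN (n : ℕ) (P : C(GaugeConfig d L (Matrix.unitaryGroup (Fin N) ℂ), ℝ)) :
    ∫ U, P U ∂(wilsonMeasure (unitaryFundamentalRep (Fin N) ℂ) β) ∈ levelValuesUN (d := d) (L := L) N β n P := by
  haveI : IsProbabilityMeasure (wilsonMeasure (d := d) (L := L) (unitaryFundamentalRep (Fin N) ℂ) β) :=
    isProbabilityMeasure_wilsonMeasure (ρ := unitaryFundamentalRep (Fin N) ℂ)
      (continuous_unitaryFundamentalRep (n := Fin N) (𝕜 := ℂ)) β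
  exact ⟨expectationFunctional (wilsonMeasure (unitaryFundamentalRep (Fin N) ℂ) β),
    isBootstrapFeasible_wilson_uN N β _ rfl (wordTruncation_subset_polyAlgebra _ n), rfl⟩

/-- ★★ **The `U(N)` word-truncation bounds converge to the Wilson value.** [folklore] -/
theorem levelValues_subset_Icc_uN {P : C(GaugeConfig d L (Matrix.unitaryGroup (Fin N) ℂ), ℝ)}
    (hP : P ∈ polyAlgebra (ι := Edge d L) (unitaryFundamentalLatticeRep N)) {ε : ℝ} (hε : 0 < ε) :
    ∀ᶠ n in atTop, levelValuesUN (d := d) (L := L) N β n P ⊆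
      Set.Icc (∫ U, P U ∂(wilsonMeasure (unitaryFundamentalRep (Fin N) ℂ) β) - ε)
        (∫ U, P U ∂(wilsonMeasure (unitaryFundamentalRep (Fin N) ℂ) β) + ε) := by
  filter_upwards [bootstrap_convergence_words_uN N β hP hε] with n hn
  rintro t ⟨φ, hφ, rfl⟩
  have h := abs_le.1 (hn φ hφ)
  exact ⟨by linarith [h.1], by linarith [h.2]⟩

/-! ## The `(Θ, S)` cut family for `U(N)` -/

/-- **The level-`n` feasible values of `P` with the `(Θ, S)` reflection cuts, `U(N)`.** [folklore] -/
def rpCutLevelValuesUN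
    (Θ : C(GaugeConfig d L (Matrix.unitaryGroup (Fin N) ℂ), GaugeConfig d L (Matrix.unitaryGroup (Fin N) ℂ)))
    (S : Set (Edge d L)) (n : ℕ) (P : C(GaugeConfig d L (Matrix.unitaryGroup (Fin N) ℂ), ℝ)) : Set ℝ :=
  {t | ∃ φ : C(GaugeConfig d L (Matrix.unitaryGroup (Fin N) ℂ), ℝ) →ₗ[ℝ] ℝ,
    IsBootstrapFeasible (unitaryFundamentalLatticeRep N) (uExp N)
        (fun _ => wilsonAction (unitaryFundamentalRep (Fin N) ℂ)) β
        (wordTruncation (ι := Edge d L) (unitaryFundamentalLatticeRep N) n) φ ∧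
      (∀ v ∈ wordTruncation (ι := Edge d L) (unitaryFundamentalLatticeRep N) n,
        DependsOn (⇑v) S → 0 ≤ φ (v.comp Θ * v)) ∧
      φ P = t}

variable {N β}
variable {Θ : C(GaugeConfig d L (Matrix.unitaryGroup (Fin N) ℂ), GaugeConfig d L (Matrix.unitaryGroup (Fin N) ℂ))}
  {S : Set (Edge d L)}

/-- More cuts, fewer feasible functionals. -/
theorem rpCutLevelValues_subset_levelValues_uN (n : ℕ) (P : C(GaugeConfig d L (Matrix.unitaryGroup (Fin N) ℂ), ℝ)) :
    rpCutLevelValuesUN N β Θ S n P ⊆ levelValuesUN (d := d) (L := L) N β n P := by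
  rintro t ⟨φ, hφ, -, rfl⟩
  exact ⟨φ, hφ, rfl⟩

/-- ★★ **Convergence** of the `U(N)` cut SDP bounds. [folklore] -/
theorem rpCutLevelValues_subset_Icc_uN {P : C(GaugeConfig d L (Matrix.unitaryGroup (Fin N) ℂ), ℝ)}
    (hP : P ∈ polyAlgebra (ι := Edge d L) (unitaryFundamentalLatticeRep N)) {ε : ℝ} (hε : 0 < ε) :
    ∀ᶠ n in atTop, rpCutLevelValuesUN N β Θ S n P ⊆
      Set.Icc (∫ U, P U ∂(wilsonMeasure (unitaryFundamentalRep (Fin N) ℂ) β) - ε)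
        (∫ U, P U ∂(wilsonMeasure (unitaryFundamentalRep (Fin N) ℂ) β) + ε) := by
  filter_upwards [levelValues_subset_Icc_uN N β hP hε] with n hn
  exact (rpCutLevelValues_subset_levelValues_uN n P).trans hn

/-- ★★ **RP ⇒ sound**: the `U(N)` Wilson value satisfies the `(Θ, S)`-cuts at every level. [folklore] -/
theorem wilson_mem_rpCutLevelValues_uN
    (hRP : ReflectionPositiveOn (wilsonMeasure (d := d) (L := L) (unitaryFundamentalRep (Fin N) ℂ) β) Θ S) (n : ℕ)
    (P : C(GaugeConfig d L (Matrix.unitaryGroup (Fin N) ℂ), ℝ)) :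
    ∫ U, P U ∂(wilsonMeasure (unitaryFundamentalRep (Fin N) ℂ) β) ∈ rpCutLevelValuesUN N β Θ S n P := by
  haveI : IsProbabilityMeasure (wilsonMeasure (d := d) (L := L) (unitaryFundamentalRep (Fin N) ℂ) β) :=
    isProbabilityMeasure_wilsonMeasure (ρ := unitaryFundamentalRep (Fin N) ℂ)
      (continuous_unitaryFundamentalRep (n := Fin N) (𝕜 := ℂ)) β
  refine ⟨expectationFunctional (wilsonMeasure (unitaryFundamentalRep (Fin N) ℂ) β),
    isBootstrapFeasible_wilson_uN N β _ rfl (wordTruncation_subset_polyAlgebra _ n), fun v _ hvS => ?_, rfl⟩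
  rw [expectationFunctional_apply]
  have h := hRP.real v hvS
  simpa only [ContinuousMap.mul_apply, ContinuousMap.comp_apply] using h

/-- ★★★ **Not RP ⇒ the `U(N)` cut SDP is INFEASIBLE at all large levels** (`Θ` a
`μ_Wilson`-preserving polynomial-stable involution). [folklore] -/
theorem rpCutLevelValues_eventually_eq_empty_uN
    (hΘμ : MeasurePreserving Θ (wilsonMeasure (d := d) (L := L) (unitaryFundamentalRep (Fin N) ℂ) β)
      (wilsonMeasure (unitaryFundamentalRep (Fin N) ℂ) β))
    (hΘΘ : ∀ U, Θ (Θ U) = U)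
    (hΘpoly : ∀ f ∈ polyAlgebra (ι := Edge d L) (unitaryFundamentalLatticeRep N),
      f.comp Θ ∈ polyAlgebra (ι := Edge d L) (unitaryFundamentalLatticeRep N))
    (hRP : ¬ ReflectionPositiveOn (wilsonMeasure (d := d) (L := L) (unitaryFundamentalRep (Fin N) ℂ) β) Θ S)
    (P : C(GaugeConfig d L (Matrix.unitaryGroup (Fin N) ℂ), ℝ)) :
    ∀ᶠ n in atTop, rpCutLevelValuesUN N β Θ S n P = ∅ := by
  haveI : IsProbabilityMeasure (wilsonMeasure (d := d) (L := L) (unitaryFundamentalRep (Fin N) ℂ) β) :=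
    isProbabilityMeasure_wilsonMeasure (ρ := unitaryFundamentalRep (Fin N) ℂ)
      (continuous_unitaryFundamentalRep (n := Fin N) (𝕜 := ℂ)) β
  have hRP' : ¬ ReflectionPositiveOn (wilsonMeasure (d := d) (L := L) (unitaryFundamentalLatticeRep N).ρ β) Θ S := hRP
  obtain ⟨f, hf, hfS, hneg⟩ :=
    exists_poly_neg_of_not_reflectionPositiveOn (unitaryFundamentalLatticeRep N) _ hΘμ hΘΘ hRP'
  have hneg' : ∫ U, f (Θ U) * f U ∂(wilsonMeasure (unitaryFundamentalRep (Fin N) ℂ) β) < 0 := hneg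
  have hQ : f.comp Θ * f ∈ polyAlgebra (ι := Edge d L) (unitaryFundamentalLatticeRep N) :=
    Subalgebra.mul_mem _ (hΘpoly f hf) hf
  have hW : ∫ U, (f.comp Θ * f) U ∂(wilsonMeasure (unitaryFundamentalRep (Fin N) ℂ) β) < 0 := by
    simpa only [ContinuousMap.mul_apply, ContinuousMap.comp_apply] using hneg'
  filter_upwards [eventually_mem_wordTruncation (unitaryFundamentalLatticeRep N) hf,
    bootstrap_convergence_words_uN (d := d) (L := L) N β hQ
      (ε := -(∫ U, (f.comp Θ * f) U ∂(wilsonMeasure (unitaryFundamentalRep (Fin N) ℂ) β)) / 2)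
      (by linarith)] with n hfn hconv
  refine Set.eq_empty_iff_forall_notMem.2 fun t ⟨φ, hφ, hcut, _⟩ => ?_
  have h0 := hcut f hfn hfS
  have h2 := (abs_le.1 (hconv φ hφ)).2
  linarith

/-- ★★★ **`U(N)`: CONSISTENT IFF REFLECTION POSITIVE.** [folklore] -/
theorem rpCuts_sound_iff_uN
    (hΘμ : MeasurePreserving Θ (wilsonMeasure (d := d) (L := L) (unitaryFundamentalRep (Fin N) ℂ) β)
      (wilsonMeasure (unitaryFundamentalRep (Fin N) ℂ) β))
    (hΘΘ : ∀ U, Θ (Θ U) = U)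
    (hΘpoly : ∀ f ∈ polyAlgebra (ι := Edge d L) (unitaryFundamentalLatticeRep N),
      f.comp Θ ∈ polyAlgebra (ι := Edge d L) (unitaryFundamentalLatticeRep N)) :
    ReflectionPositiveOn (wilsonMeasure (d := d) (L := L) (unitaryFundamentalRep (Fin N) ℂ) β) Θ S ↔
      ∀ (n : ℕ) (P : C(GaugeConfig d L (Matrix.unitaryGroup (Fin N) ℂ), ℝ)),
        ∫ U, P U ∂(wilsonMeasure (unitaryFundamentalRep (Fin N) ℂ) β) ∈ rpCutLevelValuesUN N β Θ S n P := by
  refine ⟨fun h n P => wilson_mem_rpCutLevelValues_uN h n P, fun h => ?_⟩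
  by_contra hRP
  obtain ⟨n, hn⟩ := (rpCutLevelValues_eventually_eq_empty_uN hΘμ hΘΘ hΘpoly hRP 1).exists
  have hmem := h n 1
  rw [hn] at hmem
  exact hmem

end Words

/-! ## `U(N)` on the even torus: site and link cuts along every axis are sound at EVERY `β` -/

section Torus

variable {d Q : ℕ} [NeZero Q] (N : ℕ) (β : ℝ)

/-- ★★★ **`U(N)`, every axis `k`, EVERY real `β`: the SITE cuts keep the Wilson value feasible at every
level** (`(ℤ/2Q)^d`, `Q ≥ 2`; `cubicTorus_siteRP_uN_anyBeta`). [folklore] -/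
theorem wilson_mem_siteCut_uN (hQ : 2 ≤ Q) (k : Fin d) (n : ℕ)
    (P : C(GaugeConfig d (2 * Q) (Matrix.unitaryGroup (Fin N) ℂ), ℝ)) :
    ∫ U, P U ∂(wilsonMeasure (unitaryFundamentalRep (Fin N) ℂ) β) ∈
      rpCutLevelValuesUN N β (siteReflectCM k) (halfLinks Q k) n P :=
  wilson_mem_rpCutLevelValues_uN (reflectionPositiveOn_siteReflect_uN N β hQ k) n P

/-- ★★★ **`U(N)`, every axis `k`, EVERY real `β`: the LINK cuts keep the Wilson value feasible at every
level** (`cubicTorus_linkRP_uN_anyBeta`; for `SU(2n+1)` this fails at `β < 0`). [folklore] -/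
theorem wilson_mem_linkCut_uN (hQ : 2 ≤ Q) (k : Fin d) (n : ℕ)
    (P : C(GaugeConfig d (2 * Q) (Matrix.unitaryGroup (Fin N) ℂ), ℝ)) :
    ∫ U, P U ∂(wilsonMeasure (unitaryFundamentalRep (Fin N) ℂ) β) ∈
      rpCutLevelValuesUN N β (midReflectCM k) (midHalfLinks Q k) n P :=
  wilson_mem_rpCutLevelValues_uN
    ((reflectionPositiveOn_midReflect_iff (unitaryFundamentalRep (Fin N) ℂ) β k).2
      (TiltedRP.cubicTorus_linkRP_uN_anyBeta hQ k β)) n P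

/-- ★★★ **The three families for `U(N)`** (`d ≥ 3`, `(ℤ/2Q)^d`, `Q ≥ 2`, EVERY real `β`, `N ≥ 1`, `U(1)`
included): the site cuts and the link cuts of every axis are sound at every level; the diagonal cuts
(even on gauge-invariant test functions only) are eventually violated by every feasible functional.
[folklore] -/
theorem threeFamilies_uN (hN : 1 ≤ N) (hQ : 2 ≤ Q) (k : Fin d) {i j m : Fin d} (hij : i ≠ j)
    (hmi : m ≠ i) (hmj : m ≠ j) (P : C(GaugeConfig d (2 * Q) (Matrix.unitaryGroup (Fin N) ℂ), ℝ)) :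
    (∀ n, ∫ U, P U ∂(wilsonMeasure (unitaryFundamentalRep (Fin N) ℂ) β) ∈
        rpCutLevelValuesUN N β (siteReflectCM k) (halfLinks Q k) n P) ∧
      (∀ n, ∫ U, P U ∂(wilsonMeasure (unitaryFundamentalRep (Fin N) ℂ) β) ∈
        rpCutLevelValuesUN N β (midReflectCM k) (midHalfLinks Q k) n P) ∧
      ∀ᶠ n in atTop, ∀ φ : C(GaugeConfig d (2 * Q) (Matrix.unitaryGroup (Fin N) ℂ), ℝ) →ₗ[ℝ] ℝ,
        IsBootstrapFeasible (unitaryFundamentalLatticeRep N) (uExp N)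
            (fun _ => wilsonAction (unitaryFundamentalRep (Fin N) ℂ)) β
            (wordTruncation (ι := Edge d (2 * Q)) (unitaryFundamentalLatticeRep N) n) φ →
          ¬ ∀ v ∈ wordTruncation (ι := Edge d (2 * Q)) (unitaryFundamentalLatticeRep N) n,
              IsDiagonalHalfObservable i j (⇑v) → IsGaugeInvariant (⇑v) →
                0 ≤ φ (v.comp (diagSwapCM i j) * v) :=
  ⟨fun n => wilson_mem_siteCut_uN N β hQ k n P, fun n => wilson_mem_linkCut_uN N β hQ k n P,
    diagCuts_eventually_infeasible_uN N β hN (even_two_mul Q) hij hmi hmj⟩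

end Torus

end Summit.QuantumFields.GaugeBoot

end
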